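import Literature.Analysis.FunctionSpaces.TorusAgmonLatticeSum
import Literature.Analysis.FunctionSpaces.LatticeConvolution
import HarnessLib

/-!
# The lattice product law `H¹ · H¹ ⊂ H^{1/2}` on `ℤ³`, Fourier side

Analysis/FunctionSpaces support file (everything proved; no definitions, no named facts), sequel of
`TorusAgmonLatticeSum.lean` and `LatticeConvolution.lean`.  On a three-dimensional lattice `ℤ^d`
(`card d = 3`), with the Japanese bracket `⟨k⟩² = 1 + |k|²` of `Torus.sobolevWeight`, we prove the
**kernel estimate**

  `∑_{j ∈ ℤ³} ⟨k - j⟩⁻² ⟨j⟩⁻² ≤ K₁ ⟨k⟩⁻¹`        (`Lattice.tsum_inv_weight_mul_inv_weight_le`)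

and deduce, by the weighted Cauchy–Schwarz inequality of `LatticeConvolution`
(`Lattice.sq_tsum_mul_le`) and Tonelli, the **product law** for `ℝ≥0∞`-valued families `U, W` on `ℤ³`

  `∑_k ⟨k⟩ (∑_j U(k - j) W(j))² ≤ K (∑_j ⟨j⟩² U(j)²) (∑_j ⟨j⟩² W(j)²)`   (`Lattice.tsum_weight_mul_conv_sq_le`),

i.e. `‖u w‖_{H^{1/2}(T³)} ≤ C ‖u‖_{H¹} ‖w‖_{H¹}` read on the absolute values of the Fourier
coefficients (`Lattice.tsum_weight_mul_conv_enorm_sq_le_eNormSq` is the same in the vocabulary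
`Lattice.eNormSq 1` of `LatticeSobolev`).  This is the case `s = t = 1`, `n = 3` of the standard
product estimate `H^s · H^t ⊂ H^{s+t-n/2}` (`s, t < n/2 < s + t`), whose Fourier proof is exactly the
kernel estimate `∑_j ⟨k-j⟩^{-2s}⟨j⟩^{-2t} ≲ ⟨k⟩^{n-2s-2t}`; it is the harmonic-analysis input of the
Fujita–Kato estimate `‖A^{-1/4} P B(u, v)‖ ≤ C ‖A^{1/2} u‖ ‖A^{1/2} v‖` for the Navier–Stokes
bilinear term on `T³` (Constantin–Foias 1988, Ch. 6, (6.9)–(6.10), the trilinear estimates with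
`s₁ = s₂ = 1`, `s₃ = 1/2`; Fujita–Kato 1964).

## The proof of the kernel estimate (region-free)

For `a = ⟨k-j⟩²`, `b = ⟨j⟩²`, `c = ⟨k⟩²` one has `c ≤ 2a + 2b` (parallelogram law), whence the
pointwise inequality `1/(ab) ≤ 5/(a(a+c)) + 5/(b(b+c))` (`Lattice.inv_mul_inv_le`: if `a ≤ b` then
`a + c ≤ 5b`, and symmetrically).  Summing over `j` (the first sum is the second after `j ↦ k - j`) reduces
the kernel estimate to the ONE-CENTRE resolvent sum `∑_j 1/(⟨j⟩²(⟨j⟩² + c)) ≤ K₀ c^{-1/2}` (`c ≥ 1`,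
`Lattice.tsum_inv_weight_mul_weight_add_le`), which is the lattice sum of Agmon's inequality
`∑_{j ≠ 0} ρ/(μⱼ(μⱼ + ρ)) ≤ C ρ^{1/2}`, `μⱼ = 4π²|j|²`, `ρ = 4π²c`, of `Torus.tsum_agmonWeight_le`
(proved in the tree through the heat trace), plus the term `j = 0`.  No dyadic decomposition and
no lattice-point counting is needed.

## Mathlib / tree search

Tree: `Torus.tsum_agmonWeight_le`, `Torus.summable_agmonWeight` (`TorusAgmonLatticeSum`),
`Lattice.sq_tsum_mul_le`, `Lattice.tsum_sub_left_eq`, `Lattice.tsum_sub_right_eq`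
(`LatticeConvolution`), `Torus.freqNormSq`, `Torus.sobolevWeight_one_sq` (`TorusSobolevNorm`);
the continuum analogue on `ℝ³` is `FourierProductLaw.lintegral_enorm_mul_lconv_sq_le`
(`SobolevProductLawFourier`).  Nothing on lattice product laws (searched `product law`, `conv_sq_le`,
`kernel` in `Literature/Analysis/FunctionSpaces`).  Mathlib: `ENNReal.tsum_comm`,
`ENNReal.tsum_mul_left`, `ENNReal.ofReal_tsum_of_nonneg`, `tsum_ite_eq`.

## References

* P. Constantin, C. Foias, *Navier–Stokes Equations*, Univ. Chicago Press (1988), Ch. 6,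
  (6.9)–(6.10) (the trilinear estimates behind `B`). [ConstantinFoiasNSE1988]
* H. Bahouri, J.-Y. Chemin, R. Danchin, *Fourier Analysis and Nonlinear PDE*, Springer (2011),
  Cor. 2.55 (product laws in Sobolev spaces). [BahouriCheminDanchin2011]
* H. Fujita, T. Kato, On the Navier–Stokes initial value problem. I, Arch. Rational Mech. Anal. 16
  (1964) 269–315, Lemma 1.3–1.4. [FujitaKato1964ARMA]
-/

noncomputable section

open scoped ENNReal NNReal
open Real

namespace Literature.Analysis.FunctionSpaces

namespace Lattice

open Torus

variable {d : Type*} [Fintype d]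

/-! ### Two elementary inequalities -/

/-- Parallelogram bound on the lattice: `|k|² ≤ 2|j|² + 2|k - j|²`. [folklore] -/
theorem freqNormSq_le_two_mul_add (k j : d → ℤ) :
    freqNormSq k ≤ 2 * freqNormSq j + 2 * freqNormSq (k - j) := by
  unfold freqNormSq
  rw [Finset.mul_sum, Finset.mul_sum, ← Finset.sum_add_distrib]
  refine Finset.sum_le_sum fun i _ => ?_
  have h : (k i : ℝ) = (j i : ℝ) + ((k - j) i : ℝ) := by simp [Pi.sub_apply]
  rw [h]
  nlinarith [sq_nonneg ((j i : ℝ) - ((k - j) i : ℝ))]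

omit [Fintype d] in
/-- The pointwise inequality behind the kernel estimate: for `a, b > 0` and `0 ≤ c ≤ 2a + 2b`,
`a⁻¹ b⁻¹ ≤ 5 (a(a+c))⁻¹ + 5 (b(b+c))⁻¹` (by symmetry assume `a ≤ b`; then `a + c ≤ 5b` and
`a(a+c) ≤ 5ab`). [folklore] -/
theorem inv_mul_inv_le {a b c : ℝ} (ha : 0 < a) (hb : 0 < b) (hc : 0 ≤ c)
    (hcab : c ≤ 2 * a + 2 * b) :
    a⁻¹ * b⁻¹ ≤ 5 * (a * (a + c))⁻¹ + 5 * (b * (b + c))⁻¹ := by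
  have hA : 0 < a * (a + c) := by positivity
  have hB : 0 < b * (b + c) := by positivity
  have hA' : 0 ≤ 5 * (a * (a + c))⁻¹ := by positivity
  have hB' : 0 ≤ 5 * (b * (b + c))⁻¹ := by positivity
  rw [← mul_inv]
  rcases le_total a b with hab | hab
  · have h : (a * b)⁻¹ ≤ 5 * (a * (a + c))⁻¹ := by
      rw [← one_div, ← div_eq_mul_inv, div_le_div_iff₀ (by positivity) hA]
      nlinarith [mul_le_mul_of_nonneg_left (show a + c ≤ 5 * b by linarith) ha.le]
    linarith
  · have h : (a * b)⁻¹ ≤ 5 * (b * (b + c))⁻¹ := by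
      rw [← one_div, ← div_eq_mul_inv, div_le_div_iff₀ (by positivity) hB]
      nlinarith [mul_le_mul_of_nonneg_left (show b + c ≤ 5 * a by linarith) hb.le]
    linarith

/-! ### The one-centre resolvent sum, from Agmon's lattice sum -/

/-- **One-centre resolvent sum on `ℤ³`**: there is `K₀ ≥ 0` with
`∑_{j ∈ ℤ³} 1/(⟨j⟩²(⟨j⟩² + c)) ≤ K₀ c^{-1/2}` for every `c ≥ 1` (`⟨j⟩² = 1 + |j|²`).  Proof: for
`j ≠ 0` the term is at most `1/(|j|²(|j|² + c)) = (4π²/c) · ρ/(μⱼ(μⱼ + ρ))` with `μⱼ = 4π²|j|²`,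
`ρ = 4π²c`, so Agmon's lattice sum `Torus.tsum_agmonWeight_le` bounds the sum off the origin by
`(4π²/c) C (4π²c)^{1/2} = 8π³ C c^{-1/2}`; the origin contributes `1/(1+c) ≤ c^{-1/2}`.
[folklore] -/
theorem tsum_inv_weight_mul_weight_add_le (hd : Fintype.card d = 3) :
    ∃ K₀ : ℝ, 0 ≤ K₀ ∧ ∀ c : ℝ, 1 ≤ c →
      ∑' j : d → ℤ, ENNReal.ofReal (((1 + freqNormSq j) * (1 + freqNormSq j + c))⁻¹) ≤
        ENNReal.ofReal (K₀ * c ^ (-(1 / 2 : ℝ))) := by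
  classical
  haveI : Nonempty d := by
    rw [← Fintype.card_pos_iff, hd]; norm_num
  obtain ⟨C, hC, hA⟩ := Torus.tsum_agmonWeight_le (d := d) hd
  refine ⟨1 + 8 * π ^ 3 * C, by positivity, fun c hc => ?_⟩
  have hc0 : 0 < c := by linarith
  set ρ : ℝ := 4 * π ^ 2 * c with hρ_def
  have hρ : 0 < ρ := by positivity
  set ag : (d → ℤ) → ℝ := fun k => if k = 0 then (0 : ℝ) else
    ρ / (4 * π ^ 2 * freqNormSq k * (4 * π ^ 2 * freqNormSq k + ρ)) with hag_def
  have hag0 : ∀ k, 0 ≤ ag k := fun k => by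
    simp only [hag_def]
    split_ifs
    · exact le_rfl
    · have := freqNormSq_nonneg k
      positivity
  have hags : Summable ag := Torus.summable_agmonWeight hd.le hρ
  set f : (d → ℤ) → ℝ := fun j => ((1 + freqNormSq j) * (1 + freqNormSq j + c))⁻¹ with hf_def
  have hf0 : ∀ j, 0 ≤ f j := fun j => by
    have := freqNormSq_nonneg j
    simp only [hf_def]
    positivity
  -- termwise comparison with the Agmon weights
  have hterm : ∀ j, f j ≤ (if j = 0 then (1 + c)⁻¹ else 0) + 4 * π ^ 2 / c * ag j := by
    intro j
    by_cases hj : j = 0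
    · subst hj
      simp only [hf_def, hag_def, if_true, freqNormSq_zero, add_zero, one_mul, mul_zero, le_refl]
    · have hn : 1 ≤ freqNormSq j := one_le_freqNormSq_of_ne_zero hj
      simp only [hf_def, hag_def, if_neg hj, zero_add]
      have hπ : (0 : ℝ) < π := Real.pi_pos
      have e : 4 * π ^ 2 / c * (ρ / (4 * π ^ 2 * freqNormSq j * (4 * π ^ 2 * freqNormSq j + ρ))) =
          (freqNormSq j * (freqNormSq j + c))⁻¹ := by
        rw [hρ_def]
        field_simp
      rw [e, ← one_div, ← one_div]
      exact one_div_le_one_div_of_le (by positivity) (by nlinarith)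
  -- the sum of the majorant
  have hite : ∑' j : d → ℤ, ENNReal.ofReal (if j = 0 then (1 + c)⁻¹ else 0) =
      ENNReal.ofReal ((1 + c)⁻¹) := by
    have e : (fun j : d → ℤ => ENNReal.ofReal (if j = 0 then (1 + c)⁻¹ else 0)) =
        fun j => if j = 0 then ENNReal.ofReal ((1 + c)⁻¹) else 0 := by
      funext j
      split_ifs <;> simp
    rw [e, tsum_ite_eq]
  have hagsum : ∑' j : d → ℤ, ENNReal.ofReal (4 * π ^ 2 / c * ag j) ≤
      ENNReal.ofReal (4 * π ^ 2 / c * (C * ρ ^ (1 / 2 : ℝ))) := by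
    have e : (fun j : d → ℤ => ENNReal.ofReal (4 * π ^ 2 / c * ag j)) =
        fun j => ENNReal.ofReal (4 * π ^ 2 / c) * ENNReal.ofReal (ag j) := by
      funext j
      exact ENNReal.ofReal_mul (by positivity)
    rw [e, ENNReal.tsum_mul_left, ← ENNReal.ofReal_tsum_of_nonneg hag0 hags,
      ← ENNReal.ofReal_mul (by positivity)]
    exact ENNReal.ofReal_le_ofReal (mul_le_mul_of_nonneg_left (hA ρ hρ) (by positivity))
  -- the final real inequality
  have hreal : (1 + c)⁻¹ + 4 * π ^ 2 / c * (C * ρ ^ (1 / 2 : ℝ)) ≤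
      (1 + 8 * π ^ 3 * C) * c ^ (-(1 / 2 : ℝ)) := by
    set s : ℝ := Real.sqrt c with hs_def
    have hs0 : 0 < s := Real.sqrt_pos.2 hc0
    have hs1 : 1 ≤ s := by rw [hs_def, ← Real.sqrt_one]; exact Real.sqrt_le_sqrt hc
    have hcs : c = s ^ 2 := by rw [hs_def, Real.sq_sqrt hc0.le]
    have e1 : c ^ (-(1 / 2 : ℝ)) = s⁻¹ := by
      rw [Real.rpow_neg hc0.le, ← Real.sqrt_eq_rpow]
    have e2 : ρ ^ (1 / 2 : ℝ) = 2 * π * s := by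
      rw [← Real.sqrt_eq_rpow, hρ_def, show 4 * π ^ 2 * c = (2 * π) ^ 2 * c by ring,
        Real.sqrt_mul (by positivity), Real.sqrt_sq (by positivity)]
    rw [e1, e2, hcs]
    have h1 : (1 + s ^ 2)⁻¹ ≤ s⁻¹ := by
      rw [← one_div, ← one_div]
      exact one_div_le_one_div_of_le hs0 (by nlinarith)
    have h2 : 4 * π ^ 2 / s ^ 2 * (C * (2 * π * s)) = 8 * π ^ 3 * C * s⁻¹ := by
      field_simp
      ring
    rw [h2]
    nlinarith
  calc ∑' j : d → ℤ, ENNReal.ofReal (f j)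
      ≤ ∑' j : d → ℤ, (ENNReal.ofReal (if j = 0 then (1 + c)⁻¹ else 0) +
          ENNReal.ofReal (4 * π ^ 2 / c * ag j)) :=
        ENNReal.tsum_le_tsum fun j => by
          rw [← ENNReal.ofReal_add (by split_ifs <;> positivity)
            (mul_nonneg (by positivity) (hag0 j))]
          exact ENNReal.ofReal_le_ofReal (hterm j)
    _ = ENNReal.ofReal ((1 + c)⁻¹) + ∑' j : d → ℤ, ENNReal.ofReal (4 * π ^ 2 / c * ag j) := by
        rw [ENNReal.tsum_add, hite]
    _ ≤ ENNReal.ofReal ((1 + c)⁻¹) + ENNReal.ofReal (4 * π ^ 2 / c * (C * ρ ^ (1 / 2 : ℝ))) :=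
        add_le_add le_rfl hagsum
    _ = ENNReal.ofReal ((1 + c)⁻¹ + 4 * π ^ 2 / c * (C * ρ ^ (1 / 2 : ℝ))) :=
        (ENNReal.ofReal_add (by positivity) (by positivity)).symm
    _ ≤ ENNReal.ofReal ((1 + 8 * π ^ 3 * C) * c ^ (-(1 / 2 : ℝ))) := ENNReal.ofReal_le_ofReal hreal

/-! ### The kernel estimate -/

/-- **The lattice kernel estimate in dimension three**: there is `K₁ ≥ 0` such that for every
`k ∈ ℤ³`, `∑_{j ∈ ℤ³} ⟨k-j⟩⁻² ⟨j⟩⁻² ≤ K₁ ⟨k⟩⁻¹` (`⟨k⟩² = 1 + |k|²`; the sum written with the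
`ℝ≥0∞` weights `ENNReal.ofReal (1 + |·|²)`).  This is the kernel of the weighted Cauchy–Schwarz
proof of `H¹ · H¹ ⊂ H^{1/2}` on `T³`.  Proof: `Lattice.inv_mul_inv_le` with `a = ⟨k-j⟩²`,
`b = ⟨j⟩²`, `c = ⟨k⟩² ≤ 2a + 2b`, the reflection `j ↦ k - j`, and
`Lattice.tsum_inv_weight_mul_weight_add_le`. [folklore] -/
theorem tsum_inv_weight_mul_inv_weight_le (hd : Fintype.card d = 3) :
    ∃ K₁ : ℝ, 0 ≤ K₁ ∧ ∀ k : d → ℤ,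
      ∑' j : d → ℤ, (ENNReal.ofReal (1 + freqNormSq (k - j)))⁻¹ * (ENNReal.ofReal (1 + freqNormSq j))⁻¹ ≤
        ENNReal.ofReal (K₁ * (1 + freqNormSq k) ^ (-(1 / 2 : ℝ))) := by
  obtain ⟨K₀, hK₀, h⟩ := tsum_inv_weight_mul_weight_add_le hd
  refine ⟨10 * K₀, by positivity, fun k => ?_⟩
  set c : ℝ := 1 + freqNormSq k with hc_def
  have hc : 1 ≤ c := by have := freqNormSq_nonneg k; linarith
  have hc0 : 0 ≤ c := by linarith
  set f : (d → ℤ) → ℝ := fun j => ((1 + freqNormSq j) * (1 + freqNormSq j + c))⁻¹ with hf_def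
  have hf0 : ∀ j, 0 ≤ f j := fun j => by
    have := freqNormSq_nonneg j
    simp only [hf_def]
    positivity
  have hpos : ∀ j : d → ℤ, 0 < 1 + freqNormSq j := fun j => by
    have := freqNormSq_nonneg j; linarith
  -- pointwise
  have hpt : ∀ j, (ENNReal.ofReal (1 + freqNormSq (k - j)))⁻¹ * (ENNReal.ofReal (1 + freqNormSq j))⁻¹ ≤
      ENNReal.ofReal (5 * f (k - j)) + ENNReal.ofReal (5 * f j) := by
    intro j
    have hcab : c ≤ 2 * (1 + freqNormSq (k - j)) + 2 * (1 + freqNormSq j) := by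
      have := freqNormSq_le_two_mul_add k j
      rw [hc_def]
      linarith
    have hreal := inv_mul_inv_le (hpos (k - j)) (hpos j) hc0 hcab
    rw [← ENNReal.ofReal_inv_of_pos (hpos _), ← ENNReal.ofReal_inv_of_pos (hpos _),
      ← ENNReal.ofReal_mul (inv_nonneg.2 (hpos _).le),
      ← ENNReal.ofReal_add (mul_nonneg (by norm_num) (hf0 _)) (mul_nonneg (by norm_num) (hf0 _))]
    exact ENNReal.ofReal_le_ofReal hreal
  -- the two sums are equal and bounded by `5 K₀ c^{-1/2}`
  have hS : ∑' j : d → ℤ, ENNReal.ofReal (5 * f j) ≤ ENNReal.ofReal (5 * (K₀ * c ^ (-(1 / 2 : ℝ)))) := by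
    have e : (fun j : d → ℤ => ENNReal.ofReal (5 * f j)) =
        fun j => ENNReal.ofReal 5 * ENNReal.ofReal (f j) := by
      funext j
      exact ENNReal.ofReal_mul (by norm_num)
    rw [e, ENNReal.tsum_mul_left, ENNReal.ofReal_mul (by norm_num : (0 : ℝ) ≤ 5)]
    exact mul_le_mul_right (h c hc) _
  have hS' : ∑' j : d → ℤ, ENNReal.ofReal (5 * f (k - j)) = ∑' j : d → ℤ, ENNReal.ofReal (5 * f j) :=
    tsum_sub_left_eq (fun j => ENNReal.ofReal (5 * f j)) k
  calc ∑' j : d → ℤ, (ENNReal.ofReal (1 + freqNormSq (k - j)))⁻¹ * (ENNReal.ofReal (1 + freqNormSq j))⁻¹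
      ≤ ∑' j : d → ℤ, (ENNReal.ofReal (5 * f (k - j)) + ENNReal.ofReal (5 * f j)) :=
        ENNReal.tsum_le_tsum hpt
    _ = ∑' j : d → ℤ, ENNReal.ofReal (5 * f (k - j)) + ∑' j : d → ℤ, ENNReal.ofReal (5 * f j) :=
        ENNReal.tsum_add
    _ ≤ ENNReal.ofReal (5 * (K₀ * c ^ (-(1 / 2 : ℝ)))) + ENNReal.ofReal (5 * (K₀ * c ^ (-(1 / 2 : ℝ)))) := by
        rw [hS']
        exact add_le_add hS hS
    _ = ENNReal.ofReal (10 * K₀ * c ^ (-(1 / 2 : ℝ))) := by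
        rw [← ENNReal.ofReal_add (by positivity) (by positivity)]
        congr 1
        ring

/-! ### The product law -/

/-- **The lattice product law `H¹ · H¹ ⊂ H^{1/2}` on `ℤ³`** (Fourier side of
`‖u w‖_{H^{1/2}(T³)} ≤ C ‖u‖_{H¹(T³)} ‖w‖_{H¹(T³)}`): there is `K ≥ 0` such that for all families
`U, W : ℤ³ → [0, ∞]`,
`∑_k ⟨k⟩ (∑_j U(k-j) W(j))² ≤ K (∑_j ⟨j⟩² U(j)²) (∑_j ⟨j⟩² W(j)²)`, `⟨k⟩ = (1 + |k|²)^{1/2}`.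
Proof: for each `k`, the weighted Cauchy–Schwarz inequality `Lattice.sq_tsum_mul_le` with weights
`⟨k-j⟩⁻²⟨j⟩⁻²` and the kernel estimate `Lattice.tsum_inv_weight_mul_inv_weight_le` give
`⟨k⟩ (∑_j U(k-j)W(j))² ≤ K₁ ∑_j ⟨k-j⟩² U(k-j)² ⟨j⟩² W(j)²`; summing over `k` (Tonelli and the
translation `k ↦ k + j`) gives the product of the two `H¹` sums (Constantin–Foias 1988, Ch. 6,
(6.9)–(6.10): the case `s₁ = s₂ = 1`, `s₃ = 1/2` of the trilinear estimates; Bahouri–Chemin–Danchin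
2011, Cor. 2.55). [folklore] -/
theorem tsum_weight_mul_conv_sq_le (hd : Fintype.card d = 3) :
    ∃ K : ℝ, 0 ≤ K ∧ ∀ U W : (d → ℤ) → ℝ≥0∞,
      ∑' k : d → ℤ, ENNReal.ofReal ((1 + freqNormSq k) ^ (1 / 2 : ℝ)) * (∑' j, U (k - j) * W j) ^ 2 ≤
        ENNReal.ofReal K * ((∑' j, ENNReal.ofReal (1 + freqNormSq j) * U j ^ 2) *
          (∑' j, ENNReal.ofReal (1 + freqNormSq j) * W j ^ 2)) := by
  obtain ⟨K₁, hK₁, hker⟩ := tsum_inv_weight_mul_inv_weight_le hd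
  refine ⟨K₁, hK₁, fun U W => ?_⟩
  set w : (d → ℤ) → ℝ≥0∞ := fun j => ENNReal.ofReal (1 + freqNormSq j) with hw_def
  have hpos : ∀ j : d → ℤ, 0 < 1 + freqNormSq j := fun j => by
    have := freqNormSq_nonneg j; linarith
  have hw0 : ∀ j, w j ≠ 0 := fun j => (ENNReal.ofReal_pos.2 (hpos j)).ne'
  have hwt : ∀ j, w j ≠ ∞ := fun j => ENNReal.ofReal_ne_top
  set F : (d → ℤ) → ℝ≥0∞ := fun j => w j * U j ^ 2 with hF_def
  set G : (d → ℤ) → ℝ≥0∞ := fun j => w j * W j ^ 2 with hG_def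
  -- per-frequency weighted Cauchy–Schwarz
  have hCS : ∀ k, (∑' j, U (k - j) * W j) ^ 2 ≤
      (∑' j, (w (k - j))⁻¹ * (w j)⁻¹) * ∑' j, F (k - j) * G j := by
    intro k
    have h := sq_tsum_mul_le (fun j => (w (k - j))⁻¹ * (w j)⁻¹)
      (fun j => w (k - j) * w j * (U (k - j) * W j))
    have e1 : ∀ j, (w (k - j))⁻¹ * (w j)⁻¹ * (w (k - j) * w j * (U (k - j) * W j)) =
        U (k - j) * W j := by
      intro j
      calc (w (k - j))⁻¹ * (w j)⁻¹ * (w (k - j) * w j * (U (k - j) * W j))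
          = ((w (k - j))⁻¹ * w (k - j)) * ((w j)⁻¹ * w j) * (U (k - j) * W j) := by ring
        _ = U (k - j) * W j := by
            rw [ENNReal.inv_mul_cancel (hw0 _) (hwt _), ENNReal.inv_mul_cancel (hw0 _) (hwt _),
              one_mul, one_mul]
    have e2 : ∀ j, (w (k - j))⁻¹ * (w j)⁻¹ * (w (k - j) * w j * (U (k - j) * W j)) ^ 2 =
        F (k - j) * G j := by
      intro j
      calc (w (k - j))⁻¹ * (w j)⁻¹ * (w (k - j) * w j * (U (k - j) * W j)) ^ 2
          = ((w (k - j))⁻¹ * w (k - j)) * ((w j)⁻¹ * w j) *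
              ((w (k - j) * U (k - j) ^ 2) * (w j * W j ^ 2)) := by ring
        _ = F (k - j) * G j := by
            rw [ENNReal.inv_mul_cancel (hw0 _) (hwt _), ENNReal.inv_mul_cancel (hw0 _) (hwt _),
              one_mul, one_mul]
    simp only [e1, e2] at h
    exact h
  -- `⟨k⟩ · kernel ≤ K₁`
  have hwk : ∀ k, ENNReal.ofReal ((1 + freqNormSq k) ^ (1 / 2 : ℝ)) *
      (∑' j, (w (k - j))⁻¹ * (w j)⁻¹) ≤ ENNReal.ofReal K₁ := by
    intro k
    have hc : 0 < 1 + freqNormSq k := hpos k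
    calc ENNReal.ofReal ((1 + freqNormSq k) ^ (1 / 2 : ℝ)) * (∑' j, (w (k - j))⁻¹ * (w j)⁻¹)
        ≤ ENNReal.ofReal ((1 + freqNormSq k) ^ (1 / 2 : ℝ)) *
            ENNReal.ofReal (K₁ * (1 + freqNormSq k) ^ (-(1 / 2 : ℝ))) :=
          mul_le_mul_right (hker k) _
      _ = ENNReal.ofReal K₁ := by
          rw [← ENNReal.ofReal_mul (Real.rpow_nonneg hc.le _)]
          congr 1
          rw [mul_left_comm, ← Real.rpow_add hc]
          norm_num
  calc ∑' k : d → ℤ, ENNReal.ofReal ((1 + freqNormSq k) ^ (1 / 2 : ℝ)) * (∑' j, U (k - j) * W j) ^ 2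
      ≤ ∑' k : d → ℤ, ENNReal.ofReal ((1 + freqNormSq k) ^ (1 / 2 : ℝ)) *
          ((∑' j, (w (k - j))⁻¹ * (w j)⁻¹) * ∑' j, F (k - j) * G j) :=
        ENNReal.tsum_le_tsum fun k => mul_le_mul_right (hCS k) _
    _ ≤ ∑' k : d → ℤ, ENNReal.ofReal K₁ * ∑' j, F (k - j) * G j :=
        ENNReal.tsum_le_tsum fun k => by
          rw [← mul_assoc]
          exact mul_le_mul_left (hwk k) _
    _ = ENNReal.ofReal K₁ * ∑' k : d → ℤ, ∑' j, F (k - j) * G j := ENNReal.tsum_mul_left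
    _ = ENNReal.ofReal K₁ * ((∑' j, F j) * ∑' j, G j) := by
        congr 1
        rw [ENNReal.tsum_comm]
        calc ∑' j, ∑' k : d → ℤ, F (k - j) * G j = ∑' j, (∑' k : d → ℤ, F (k - j)) * G j :=
              tsum_congr fun j => ENNReal.tsum_mul_right
          _ = ∑' j, (∑' k : d → ℤ, F k) * G j :=
              tsum_congr fun j => by rw [tsum_sub_right_eq F j]
          _ = (∑' k, F k) * ∑' j, G j := ENNReal.tsum_mul_left

/-- **The lattice product law in the `H_s`-norm vocabulary of `LatticeSobolev`**: for coefficient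
families `c₁, c₂ : ℤ³ → V` in normed groups,
`∑_k ⟨k⟩ (∑_j ‖c₁(k-j)‖ ‖c₂(j)‖)² ≤ K ‖c₁‖²_{H_1} ‖c₂‖²_{H_1}` (`Lattice.eNormSq 1`), the form in
which the `H^{1/2}` norm of a product `u w` of two `H¹(T³)` functions is controlled through
`|𝓕(u w)(k)| ≤ ∑_j |û(k-j)| |ŵ(j)|` (Constantin–Foias 1988, Ch. 6, (6.9)–(6.10);
Bahouri–Chemin–Danchin 2011, Cor. 2.55). [folklore] -/
theorem tsum_weight_mul_conv_enorm_sq_le_eNormSq (hd : Fintype.card d = 3) :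
    ∃ K : ℝ, 0 ≤ K ∧ ∀ {V W : Type*} [NormedAddCommGroup V] [NormedAddCommGroup W]
      (c₁ : (d → ℤ) → V) (c₂ : (d → ℤ) → W),
      ∑' k : d → ℤ, ENNReal.ofReal (sobolevWeight 1 k) * (∑' j, ‖c₁ (k - j)‖ₑ * ‖c₂ j‖ₑ) ^ 2 ≤
        ENNReal.ofReal K * (eNormSq 1 c₁ * eNormSq 1 c₂) := by
  obtain ⟨K, hK, h⟩ := tsum_weight_mul_conv_sq_le hd
  refine ⟨K, hK, fun c₁ c₂ => ?_⟩
  simp only [eNormSq, sobolevWeight_one_sq]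
  exact h (fun j => ‖c₁ j‖ₑ) (fun j => ‖c₂ j‖ₑ)

end Lattice

end Literature.Analysis.FunctionSpaces

end
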